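/-
Copyright (c) 2026. All rights reserved.
Released under Apache 2.0 license as described in the file LICENSE.
Authors: abc-iut cell, wave-4 seat abc-iut-w4-d082 (L3 sub-DAG #4 «Thm 5.4», row T54-6; proof-only).
-/
import Literature.AnabelianGeometry.SemiGraphs.ArithmeticCoverings
import Literature.AnabelianGeometry.SemiGraphs.ArithmeticCategory
import Literature.AnabelianGeometry.SemiGraphs.TemperoidsResProofs
import Mathlib.Tactic.Group
import HarnessLib

/-!
# [SemiAnbd] Theorem 5.4 (iii), clause 2: "up to inner automorphism" on both sides — PROOFS (row T54-6)

Mochizuki, *Semi-graphs of anabelioids*, Publ. RIMS **42** (2006) [MochizukiSemiAnbd2006], Thm 5.4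
(iii) p. 66: "applying `B^temp(−)` determines a natural bijective correspondence between locally open
morphisms `𝔊 → ℍ` over `A` and arithmetically quasi-geometric morphisms of temperoids
`B^temp(𝔊) → B^temp(ℍ)` over `A^⊤`" — where (Def 5.1 (iv) p. 63) morphisms `𝔊 → ℍ` are "regard[ed] up to
composition with the inner action of `π̂₁(A)`" and (Prop 3.2 p. 35, Rmk 3.2.1) morphisms of connected
temperoids are continuous homomorphisms of tempered fundamental groups up to inner automorphisms of the
target.  The SECOND CLAUSE of abc-iut-L3-t3's typed statement
`ArithQuasiGeometricCorrespondenceStatement 𝔊 ℍ e augG augH btemp` (`ArithmeticCoverings.lean`,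
FROZEN-shape p407115) renders the well-definedness/injectivity of this correspondence on classes:
`ArithHom.InnerEquiv φ ψ ↔ ∃ h, ∀ g, btemp ψ g = h * btemp φ g * h⁻¹`, for `φ`, `ψ` locally open OVER `A`
(`ArithHom.IsOverA 𝔊 ℍ e`: arithmetic component equal to the fixed identification `e : π̂₁(A) = π̂₁(A)`).

PROOF-ONLY companion (cell abc-iut, layer L3, sub-DAG `HOME/plan/L3/SUBDAG-SemiAnbd-Thm54.md`, row
**T54-6**, node `SemiAnbd:Thm5.4(iii)`; no definitions, no new `Prop` facts).  In the typed statement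
the map "apply `B^temp(−)`", `btemp`, is an explicit PARAMETER (its construction — `π₁^temp` of the
connected temperoid `B^temp(𝔊)`, Prop 3.6 (iv) functoriality — is the producer row T54-0).  What is
proved:

* `innerEquiv_iff_eq_of_isOverA` — **OVER `A`, INNER EQUIVALENCE IS EQUALITY of representatives**
  (unconditional): if `φ`, `ψ` both have arithmetic component `e` and `ψ = ` (inner action of `a`) `∘ φ`,
  then `a` centralises `e(π̂₁(A_𝔊)) = π̂₁(A_ℍ)`, so `a = 1` because `A` is SLIM (Def 5.1 (ii): "`A` a slim
  connected anabelioid", field `ArithSemiGraph.slim`; §0 p. 6), whence `ψ = φ`.  Consequently: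
* `exists_conj_of_innerEquiv` — the FORWARD half of clause 2 (well-definedness of `[φ] ↦ [B^temp(φ)]`
  on classes of morphisms over `A`) holds OUTRIGHT for every value of the parameter `btemp` — no
  hypothesis on "apply `B^temp`" is needed;
* `innerEquiv_iff_exists_conj_of_injective` — clause 2 VERBATIM (same binders `φ ψ h₁ h₂ k₁ k₂`) from
  ONE named hypothesis `hinj`: "`btemp` is injective up to conjugacy in `Π^temp_ℍ` on locally open
  representatives over `A`" — and `clause2_iff_injective` shows this hypothesis is EXACTLY EQUIVALENT
  to clause 2.  HONEST SCOPE: `hinj` is the injectivity CONTENT of Thm 5.4 (iii) (the arithmetic twin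
  of the rigidity behind Cor 3.9: a morphism over `A` is recovered from its `B^temp`; rows T54-5/T54-7
  of the sub-DAG); it is named here, not discharged;
* `exists_conj_iff_nonempty_resIso` — **Prop 3.2 at chart level, in the orientation of clause 2**: for
  `Π^temp_ℍ` tempered, `∃ h, ∀ g, ψ' g = h·φ' g·h⁻¹` iff the pull-back functors `B^temp(φ')`,
  `B^temp(ψ')` are isomorphic (abc-iut-L3-t2's `BTemp.exists_conj_of_natTrans` / `BTemp.resIsoOfConj`,
  the discharge of record of Prop 3.2 "in particular", `ResIsoResIff_holds`); hence
  `innerEquiv_iff_exists_conj_of_faithful`: clause 2 from the FUNCTOR-LEVEL form of the residual —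
  "representatives over `A` with isomorphic pull-back functors at chart level are equal" (`hfaith`) —
  the form in which the producer (T54-0) and Cor 3.9-type rigidity (T54-7) will supply it;
* `exists_conj_refl/symm/trans`, `exists_conj_congr_left/right_of_innerEquiv` — classes of morphisms
  of temperoids are well defined (bookkeeping for "up to inner automorphism of the target");
* `arithQuasiGeometricCorrespondenceStatement_of_clauses` / `_of_injective` / `clause2_of_…` /
  `injective_of_…` — the typed statement assembles from / yields its three clauses (for the
  coordinator's assembly `arithMaximalCompact_theorem_5_4_of_rows`).

Universe note: `BTemp.res` wants the two tempered groups in one universe, so the chart-level groups of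
the `BTemp` lemmas are taken in a common universe `uG`.  No statement of the paper is strengthened;
nothing here bears on [IUTchIII] Cor. 3.12.
-/

namespace Literature.AnabelianGeometry.SemiGraphs

open _root_.CategoryTheory Literature.AlgebraicGeometry.Frobenioids

universe u v w uG uG' uH'

variable {Obj : Type u} [Category.{v} Obj] {𝓥 : SemiAnbdVocab.{u, v, w} Obj}
variable {𝔊 ℍ : ArithSemiGraph 𝓥} {e : 𝔊.PA ≃* ℍ.PA}

namespace Thm54iii

/-! ### Over `A`, inner equivalence is equality of representatives -/

/-- **Over `A`, "up to the inner action" is no identification at all**: two representatives `φ, ψ : 𝔊 → ℍ`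
whose arithmetic components both equal the fixed identification `e : π̂₁(A_𝔊) ⥲ π̂₁(A_ℍ)` are inner
equivalent iff they are EQUAL — an inner equivalence `ψ = (inner action of a) ∘ φ` forces
`a·e(a')·a⁻¹ = e(a')` for all `a'`, so `a` is central in `π̂₁(A_ℍ)`, hence `a = 1` since `A` is slim
(Def 5.1 (ii), `ArithSemiGraph.slim`; §0 p. 6 "`Z_G(H) = {1}` for every open `H`").
[cite: MochizukiSemiAnbd2006, Def 5.1 (iv), p. 63] -/
theorem innerEquiv_iff_eq_of_isOverA {φ ψ : ArithHom 𝓥 𝔊 ℍ} (hφ : ArithHom.IsOverA 𝔊 ℍ e φ)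
    (hψ : ArithHom.IsOverA 𝔊 ℍ e ψ) : ArithHom.InnerEquiv φ ψ ↔ φ = ψ := by
  constructor
  · rintro ⟨a, ha, hg⟩
    -- `a` commutes with `e(π̂₁(A_𝔊)) = π̂₁(A_ℍ)`
    have hcomm : ∀ x : ℍ.PA, x * a = a * x := by
      intro x
      obtain ⟨a', rfl⟩ := e.surjective x
      have h1 : e a' = a * e a' * a⁻¹ := by
        have h0 := ha a'
        rwa [hψ a', hφ a'] at h0
      calc e a' * a = a * e a' * a⁻¹ * a := by rw [← h1]
        _ = a * e a' := by rw [inv_mul_cancel_right]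
    have hmem : a ∈ Subgroup.centralizer (((⊤ : Subgroup ℍ.PA) : Set ℍ.PA)) := by
      rw [Subgroup.mem_centralizer_iff]
      intro x _
      exact hcomm x
    rw [ℍ.slim.centralizer_eq_bot ⊤ (by rw [Subgroup.coe_top]; exact isOpen_univ),
      Subgroup.mem_bot] at hmem
    subst hmem
    refine ArithHom.ext' (MonoidHom.ext fun a' => by rw [hφ a', hψ a']) ?_
    rw [hg, ArithHom.rho_one_hom, Category.comp_id]
  · rintro rfl
    exact ArithHom.InnerEquiv.refl φ

/-! ### Conjugacy of homomorphisms into `Π^temp_ℍ` (morphisms of temperoids up to inner automorphism) -/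

section Conj

variable {Gtp : Type uG'} [Group Gtp] {Htp : Type uH'} [Group Htp]

/-- The relation "`ψ' = γ_h ∘ φ'` for some `h`" is reflexive. [cite: MochizukiSemiAnbd2006, Prop 3.2 p.35] -/
theorem exists_conj_refl (f : Gtp →* Htp) : ∃ h : Htp, ∀ g : Gtp, f g = h * f g * h⁻¹ :=
  ⟨1, fun g => by rw [one_mul, inv_one, mul_one]⟩

/-- … symmetric. [cite: MochizukiSemiAnbd2006, Prop 3.2 p.35] -/
theorem exists_conj_symm {f f' : Gtp →* Htp} (hff' : ∃ h : Htp, ∀ g : Gtp, f' g = h * f g * h⁻¹) :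
    ∃ h : Htp, ∀ g : Gtp, f g = h * f' g * h⁻¹ := by
  obtain ⟨h, hh⟩ := hff'
  refine ⟨h⁻¹, fun g => ?_⟩
  rw [hh g]
  group

/-- … and transitive: the morphisms of temperoids `B^temp(𝔊) → B^temp(ℍ)` (continuous homomorphisms up
to inner automorphisms of the target, Rmk 3.2.1) are well defined as classes.
[cite: MochizukiSemiAnbd2006, Prop 3.2 p.35] -/
theorem exists_conj_trans {f f' f'' : Gtp →* Htp} (h₁ : ∃ h : Htp, ∀ g : Gtp, f' g = h * f g * h⁻¹)
    (h₂ : ∃ h : Htp, ∀ g : Gtp, f'' g = h * f' g * h⁻¹) :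
    ∃ h : Htp, ∀ g : Gtp, f'' g = h * f g * h⁻¹ := by
  obtain ⟨a, ha⟩ := h₁
  obtain ⟨b, hb⟩ := h₂
  refine ⟨b * a, fun g => ?_⟩
  rw [hb g, ha g]
  group

end Conj

/-! ### Thm 5.4 (iii), clause 2: the forward half outright, the backward half = injectivity -/

section Clause2

variable {Gtp : Type uG'} [Group Gtp] {Htp : Type uH'} [Group Htp]
  (btemp : (φ : ArithHom 𝓥 𝔊 ℍ) → φ.IsLocallyOpen → ArithHom.IsOverA 𝔊 ℍ e φ → (Gtp →* Htp))

/-- **Thm 5.4 (iii), clause 2, forward half — UNCONDITIONAL** ("up to the inner action" on `𝔊 → ℍ`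
implies "up to inner automorphism" on `B^temp(𝔊) → B^temp(ℍ)`): inner-equivalent locally open morphisms
over `A` have conjugate (indeed equal) images under ANY assignment `btemp`, because over `A` inner
equivalence is equality (`innerEquiv_iff_eq_of_isOverA`). [cite: MochizukiSemiAnbd2006, Thm 5.4 (iii), p. 66] -/
theorem exists_conj_of_innerEquiv {φ ψ : ArithHom 𝓥 𝔊 ℍ} (h₁ : φ.IsLocallyOpen)
    (h₂ : ArithHom.IsOverA 𝔊 ℍ e φ) (k₁ : ψ.IsLocallyOpen) (k₂ : ArithHom.IsOverA 𝔊 ℍ e ψ)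
    (hφψ : ArithHom.InnerEquiv φ ψ) :
    ∃ h : Htp, ∀ g : Gtp, btemp ψ k₁ k₂ g = h * btemp φ h₁ h₂ g * h⁻¹ := by
  obtain rfl := (innerEquiv_iff_eq_of_isOverA h₂ k₂).mp hφψ
  exact ⟨1, fun g => by rw [one_mul, inv_one, mul_one]⟩

/-- **Thm 5.4 (iii), clause 2**, the middle conjunct of abc-iut-L3-t3's
`ArithQuasiGeometricCorrespondenceStatement 𝔊 ℍ e augG augH btemp` VERBATIM, from ONE named hypothesis:
`hinj` — "apply `B^temp`" is injective up to conjugacy in `Π^temp_ℍ` on locally open representatives over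
`A` (the injectivity CONTENT of (iii): a morphism over `A` is recovered from its `B^temp`; arithmetic twin
of the rigidity behind Cor 3.9, rows T54-5/T54-7 — named, NOT discharged here).
[cite: MochizukiSemiAnbd2006, Thm 5.4 (iii), p. 66] -/
theorem innerEquiv_iff_exists_conj_of_injective
    (hinj : ∀ (φ ψ : ArithHom 𝓥 𝔊 ℍ) (h₁ : φ.IsLocallyOpen) (h₂ : ArithHom.IsOverA 𝔊 ℍ e φ)
      (k₁ : ψ.IsLocallyOpen) (k₂ : ArithHom.IsOverA 𝔊 ℍ e ψ),
      (∃ h : Htp, ∀ g : Gtp, btemp ψ k₁ k₂ g = h * btemp φ h₁ h₂ g * h⁻¹) → φ = ψ)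
    (φ ψ : ArithHom 𝓥 𝔊 ℍ) (h₁ : φ.IsLocallyOpen) (h₂ : ArithHom.IsOverA 𝔊 ℍ e φ)
    (k₁ : ψ.IsLocallyOpen) (k₂ : ArithHom.IsOverA 𝔊 ℍ e ψ) :
    ArithHom.InnerEquiv φ ψ ↔ ∃ h : Htp, ∀ g : Gtp, btemp ψ k₁ k₂ g = h * btemp φ h₁ h₂ g * h⁻¹ :=
  ⟨exists_conj_of_innerEquiv btemp h₁ h₂ k₁ k₂, fun hc =>
    (innerEquiv_iff_eq_of_isOverA h₂ k₂).mpr (hinj φ ψ h₁ h₂ k₁ k₂ hc)⟩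

/-- **The exact residual of clause 2.**  Clause 2 of the typed Thm 5.4 (iii) (for all locally open
`φ, ψ` over `A`) is EQUIVALENT to the injectivity of "apply `B^temp`" up to conjugacy on such
representatives — so the forward half carries no content and the backward half is precisely the
injectivity assertion of (iii). [cite: MochizukiSemiAnbd2006, Thm 5.4 (iii), p. 66] -/
theorem clause2_iff_injective :
    (∀ (φ ψ : ArithHom 𝓥 𝔊 ℍ) (h₁ : φ.IsLocallyOpen) (h₂ : ArithHom.IsOverA 𝔊 ℍ e φ)
        (k₁ : ψ.IsLocallyOpen) (k₂ : ArithHom.IsOverA 𝔊 ℍ e ψ),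
      ArithHom.InnerEquiv φ ψ ↔ ∃ h : Htp, ∀ g : Gtp, btemp ψ k₁ k₂ g = h * btemp φ h₁ h₂ g * h⁻¹) ↔
    ∀ (φ ψ : ArithHom 𝓥 𝔊 ℍ) (h₁ : φ.IsLocallyOpen) (h₂ : ArithHom.IsOverA 𝔊 ℍ e φ)
        (k₁ : ψ.IsLocallyOpen) (k₂ : ArithHom.IsOverA 𝔊 ℍ e ψ),
      (∃ h : Htp, ∀ g : Gtp, btemp ψ k₁ k₂ g = h * btemp φ h₁ h₂ g * h⁻¹) → φ = ψ := by
  constructor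
  · intro h φ ψ h₁ h₂ k₁ k₂ hc
    exact (innerEquiv_iff_eq_of_isOverA h₂ k₂).mp ((h φ ψ h₁ h₂ k₁ k₂).mpr hc)
  · intro hinj
    exact innerEquiv_iff_exists_conj_of_injective btemp hinj

/-- Well-definedness on classes, source side: replacing `φ` by an inner-equivalent representative over
`A` does not change the conjugacy class of `btemp φ` (no hypothesis on `btemp`).
[cite: MochizukiSemiAnbd2006, Def 5.1 (iv), p. 63] -/
theorem exists_conj_congr_left_of_innerEquiv {φ φ' ψ : ArithHom 𝓥 𝔊 ℍ} (h₁ : φ.IsLocallyOpen)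
    (h₂ : ArithHom.IsOverA 𝔊 ℍ e φ) (h₁' : φ'.IsLocallyOpen) (h₂' : ArithHom.IsOverA 𝔊 ℍ e φ')
    (k₁ : ψ.IsLocallyOpen) (k₂ : ArithHom.IsOverA 𝔊 ℍ e ψ) (hφφ' : ArithHom.InnerEquiv φ φ') :
    (∃ h : Htp, ∀ g : Gtp, btemp ψ k₁ k₂ g = h * btemp φ h₁ h₂ g * h⁻¹) ↔
      ∃ h : Htp, ∀ g : Gtp, btemp ψ k₁ k₂ g = h * btemp φ' h₁' h₂' g * h⁻¹ := by
  have hc : ∃ h : Htp, ∀ g : Gtp, btemp φ' h₁' h₂' g = h * btemp φ h₁ h₂ g * h⁻¹ :=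
    exists_conj_of_innerEquiv btemp h₁ h₂ h₁' h₂' hφφ'
  exact ⟨fun hψ => exists_conj_trans (exists_conj_symm hc) hψ, fun hψ => exists_conj_trans hc hψ⟩

/-- Well-definedness on classes, target side (no hypothesis on `btemp`).
[cite: MochizukiSemiAnbd2006, Def 5.1 (iv), p. 63] -/
theorem exists_conj_congr_right_of_innerEquiv {φ ψ ψ' : ArithHom 𝓥 𝔊 ℍ} (h₁ : φ.IsLocallyOpen)
    (h₂ : ArithHom.IsOverA 𝔊 ℍ e φ) (k₁ : ψ.IsLocallyOpen) (k₂ : ArithHom.IsOverA 𝔊 ℍ e ψ)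
    (k₁' : ψ'.IsLocallyOpen) (k₂' : ArithHom.IsOverA 𝔊 ℍ e ψ') (hψψ' : ArithHom.InnerEquiv ψ ψ') :
    (∃ h : Htp, ∀ g : Gtp, btemp ψ k₁ k₂ g = h * btemp φ h₁ h₂ g * h⁻¹) ↔
      ∃ h : Htp, ∀ g : Gtp, btemp ψ' k₁' k₂' g = h * btemp φ h₁ h₂ g * h⁻¹ := by
  have hc : ∃ h : Htp, ∀ g : Gtp, btemp ψ' k₁' k₂' g = h * btemp ψ k₁ k₂ g * h⁻¹ :=
    exists_conj_of_innerEquiv btemp k₁ k₂ k₁' k₂' hψψ'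
  exact ⟨fun hψ => exists_conj_trans hψ hc, fun hψ' => exists_conj_trans hψ' (exists_conj_symm hc)⟩

end Clause2

/-! ### Prop 3.2 at chart level, and the functor-level form of the residual -/

section Functorial

variable {Gtp : Type uG} [Group Gtp] [TopologicalSpace Gtp]
  {Htp : Type uG} [Group Htp] [TopologicalSpace Htp] [IsTopologicalGroup Htp]

/-- **[SemiAnbd] Prop 3.2 "in particular", chart level, clause-2 orientation**: for `Π₂` tempered and
continuous homomorphisms `φ', ψ' : Π₁ → Π₂`, "`ψ' = γ_h ∘ φ'` for some `h ∈ Π₂`" iff the pull-back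
functors `B^temp(φ')`, `B^temp(ψ')` are isomorphic (abc-iut-L3-t2's `BTemp.resIsoOfConj` /
`BTemp.exists_conj_of_natTrans`). [cite: MochizukiSemiAnbd2006, Prop 3.2 p.35] -/
theorem exists_conj_iff_nonempty_resIso (hH : IsTempered Htp) (φ' ψ' : Gtp →ₜ* Htp) :
    (∃ h : Htp, ∀ g : Gtp, ψ' g = h * φ' g * h⁻¹) ↔ Nonempty (BTemp.res φ' ≅ BTemp.res ψ') := by
  constructor
  · rintro ⟨h, hh⟩
    exact ⟨BTemp.resIsoOfConj φ' ψ' h fun g => (hh g).symm⟩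
  · rintro ⟨i⟩
    obtain ⟨h, hh, -⟩ := BTemp.exists_conj_of_natTrans hH φ' ψ' i.hom
    exact ⟨h, fun g => (hh g).symm⟩

variable (hH : IsTempered Htp)
  (btemp : (φ : ArithHom 𝓥 𝔊 ℍ) → φ.IsLocallyOpen → ArithHom.IsOverA 𝔊 ℍ e φ → (Gtp →* Htp))
  (hcont : ∀ (φ : ArithHom 𝓥 𝔊 ℍ) (h₁ : φ.IsLocallyOpen) (h₂ : ArithHom.IsOverA 𝔊 ℍ e φ),
    Continuous (btemp φ h₁ h₂))

include hH

/-- **Thm 5.4 (iii), clause 2, from the FUNCTOR-LEVEL form of its residual**: `hfaith` — locally open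
representatives over `A` whose `B^temp`-images have isomorphic pull-back functors `B^temp(Π^temp_ℍ) →
B^temp(Π^temp_𝔊)` at chart level are equal (faithfulness of `𝔊 ↦ B^temp(𝔊)` on morphisms over `A`, the
injectivity content of (iii) in the currency of temperoid morphisms; producer T54-0 + rigidity T54-7,
NOT discharged here) — together with Prop 3.2 (`exists_conj_iff_nonempty_resIso`) and continuity of the
images. [cite: MochizukiSemiAnbd2006, Thm 5.4 (iii), p. 66] -/
theorem innerEquiv_iff_exists_conj_of_faithful
    (hfaith : ∀ (φ ψ : ArithHom 𝓥 𝔊 ℍ) (h₁ : φ.IsLocallyOpen) (h₂ : ArithHom.IsOverA 𝔊 ℍ e φ)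
      (k₁ : ψ.IsLocallyOpen) (k₂ : ArithHom.IsOverA 𝔊 ℍ e ψ),
      Nonempty (BTemp.res (⟨btemp φ h₁ h₂, hcont φ h₁ h₂⟩ : Gtp →ₜ* Htp) ≅
        BTemp.res (⟨btemp ψ k₁ k₂, hcont ψ k₁ k₂⟩ : Gtp →ₜ* Htp)) → φ = ψ)
    (φ ψ : ArithHom 𝓥 𝔊 ℍ) (h₁ : φ.IsLocallyOpen) (h₂ : ArithHom.IsOverA 𝔊 ℍ e φ)
    (k₁ : ψ.IsLocallyOpen) (k₂ : ArithHom.IsOverA 𝔊 ℍ e ψ) :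
    ArithHom.InnerEquiv φ ψ ↔ ∃ h : Htp, ∀ g : Gtp, btemp ψ k₁ k₂ g = h * btemp φ h₁ h₂ g * h⁻¹ := by
  refine innerEquiv_iff_exists_conj_of_injective btemp (fun φ ψ h₁ h₂ k₁ k₂ hc => ?_) φ ψ h₁ h₂ k₁ k₂
  exact hfaith φ ψ h₁ h₂ k₁ k₂
    ((exists_conj_iff_nonempty_resIso hH (⟨btemp φ h₁ h₂, hcont φ h₁ h₂⟩ : Gtp →ₜ* Htp)
      (⟨btemp ψ k₁ k₂, hcont ψ k₁ k₂⟩ : Gtp →ₜ* Htp)).1 hc)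

end Functorial

/-! ### Assembly of the typed statement from its three clauses -/

section Assembly

variable {Gtp : Type uG'} [Group Gtp] [TopologicalSpace Gtp]
  {Htp : Type uH'} [Group Htp] [TopologicalSpace Htp]

/-- The typed Thm 5.4 (iii) statement `ArithQuasiGeometricCorrespondenceStatement` assembles from its
three clauses — (1) every `B^temp(φ)` of a locally open `φ` over `A` is arithmetically quasi-geometric,
(2) the clause-2 correspondence of classes (this file), (3) surjectivity onto arithmetically
quasi-geometric homomorphisms (row T54-7) — for the coordinator's assembly of sub-DAG #4.
[cite: MochizukiSemiAnbd2006, Thm 5.4 (iii), p. 66] -/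
theorem arithQuasiGeometricCorrespondenceStatement_of_clauses
    (augG : Gtp →* 𝔊.PA) (augH : Htp →* ℍ.PA)
    (btemp : (φ : ArithHom 𝓥 𝔊 ℍ) → φ.IsLocallyOpen → ArithHom.IsOverA 𝔊 ℍ e φ → (Gtp →* Htp))
    (h1 : ∀ (φ : ArithHom 𝓥 𝔊 ℍ) (h₁ : φ.IsLocallyOpen) (h₂ : ArithHom.IsOverA 𝔊 ℍ e φ),
      IsArithQuasiGeometric augG (e.symm.toMonoidHom.comp augH) (btemp φ h₁ h₂))
    (h2 : ∀ (φ ψ : ArithHom 𝓥 𝔊 ℍ) (h₁ : φ.IsLocallyOpen) (h₂ : ArithHom.IsOverA 𝔊 ℍ e φ)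
      (k₁ : ψ.IsLocallyOpen) (k₂ : ArithHom.IsOverA 𝔊 ℍ e ψ),
      ArithHom.InnerEquiv φ ψ ↔ ∃ h : Htp, ∀ g, btemp ψ k₁ k₂ g = h * btemp φ h₁ h₂ g * h⁻¹)
    (h3 : ∀ f : Gtp →* Htp, IsArithQuasiGeometric augG (e.symm.toMonoidHom.comp augH) f →
      ∃ (φ : ArithHom 𝓥 𝔊 ℍ) (h₁ : φ.IsLocallyOpen) (h₂ : ArithHom.IsOverA 𝔊 ℍ e φ) (h : Htp),
        ∀ g, f g = h * btemp φ h₁ h₂ g * h⁻¹) :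
    ArithQuasiGeometricCorrespondenceStatement 𝔊 ℍ e augG augH btemp := by
  dsimp only [ArithQuasiGeometricCorrespondenceStatement]
  exact ⟨h1, h2, h3⟩

/-- The same assembly with clause 2 replaced by its exact residual, injectivity of `btemp` up to
conjugacy on representatives over `A` (`clause2_iff_injective`).
[cite: MochizukiSemiAnbd2006, Thm 5.4 (iii), p. 66] -/
theorem arithQuasiGeometricCorrespondenceStatement_of_injective
    (augG : Gtp →* 𝔊.PA) (augH : Htp →* ℍ.PA)
    (btemp : (φ : ArithHom 𝓥 𝔊 ℍ) → φ.IsLocallyOpen → ArithHom.IsOverA 𝔊 ℍ e φ → (Gtp →* Htp))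
    (h1 : ∀ (φ : ArithHom 𝓥 𝔊 ℍ) (h₁ : φ.IsLocallyOpen) (h₂ : ArithHom.IsOverA 𝔊 ℍ e φ),
      IsArithQuasiGeometric augG (e.symm.toMonoidHom.comp augH) (btemp φ h₁ h₂))
    (hinj : ∀ (φ ψ : ArithHom 𝓥 𝔊 ℍ) (h₁ : φ.IsLocallyOpen) (h₂ : ArithHom.IsOverA 𝔊 ℍ e φ)
      (k₁ : ψ.IsLocallyOpen) (k₂ : ArithHom.IsOverA 𝔊 ℍ e ψ),
      (∃ h : Htp, ∀ g : Gtp, btemp ψ k₁ k₂ g = h * btemp φ h₁ h₂ g * h⁻¹) → φ = ψ)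
    (h3 : ∀ f : Gtp →* Htp, IsArithQuasiGeometric augG (e.symm.toMonoidHom.comp augH) f →
      ∃ (φ : ArithHom 𝓥 𝔊 ℍ) (h₁ : φ.IsLocallyOpen) (h₂ : ArithHom.IsOverA 𝔊 ℍ e φ) (h : Htp),
        ∀ g, f g = h * btemp φ h₁ h₂ g * h⁻¹) :
    ArithQuasiGeometricCorrespondenceStatement 𝔊 ℍ e augG augH btemp :=
  arithQuasiGeometricCorrespondenceStatement_of_clauses augG augH btemp h1
    (innerEquiv_iff_exists_conj_of_injective btemp hinj) h3

/-- Conversely the typed statement yields its clause 2 (so the two renderings are interchangeable for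
consumers). [cite: MochizukiSemiAnbd2006, Thm 5.4 (iii), p. 66] -/
theorem clause2_of_arithQuasiGeometricCorrespondenceStatement
    {augG : Gtp →* 𝔊.PA} {augH : Htp →* ℍ.PA}
    {btemp : (φ : ArithHom 𝓥 𝔊 ℍ) → φ.IsLocallyOpen → ArithHom.IsOverA 𝔊 ℍ e φ → (Gtp →* Htp)}
    (h : ArithQuasiGeometricCorrespondenceStatement 𝔊 ℍ e augG augH btemp)
    (φ ψ : ArithHom 𝓥 𝔊 ℍ) (h₁ : φ.IsLocallyOpen) (h₂ : ArithHom.IsOverA 𝔊 ℍ e φ)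
    (k₁ : ψ.IsLocallyOpen) (k₂ : ArithHom.IsOverA 𝔊 ℍ e ψ) :
    ArithHom.InnerEquiv φ ψ ↔ ∃ h : Htp, ∀ g, btemp ψ k₁ k₂ g = h * btemp φ h₁ h₂ g * h⁻¹ := by
  dsimp only [ArithQuasiGeometricCorrespondenceStatement] at h
  exact h.2.1 φ ψ h₁ h₂ k₁ k₂

/-- And its injectivity residual: under the typed statement, "apply `B^temp`" is injective up to
conjugacy on representatives over `A`. [cite: MochizukiSemiAnbd2006, Thm 5.4 (iii), p. 66] -/
theorem injective_of_arithQuasiGeometricCorrespondenceStatement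
    {augG : Gtp →* 𝔊.PA} {augH : Htp →* ℍ.PA}
    {btemp : (φ : ArithHom 𝓥 𝔊 ℍ) → φ.IsLocallyOpen → ArithHom.IsOverA 𝔊 ℍ e φ → (Gtp →* Htp)}
    (h : ArithQuasiGeometricCorrespondenceStatement 𝔊 ℍ e augG augH btemp)
    (φ ψ : ArithHom 𝓥 𝔊 ℍ) (h₁ : φ.IsLocallyOpen) (h₂ : ArithHom.IsOverA 𝔊 ℍ e φ)
    (k₁ : ψ.IsLocallyOpen) (k₂ : ArithHom.IsOverA 𝔊 ℍ e ψ)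
    (hc : ∃ h : Htp, ∀ g, btemp ψ k₁ k₂ g = h * btemp φ h₁ h₂ g * h⁻¹) : φ = ψ :=
  (clause2_iff_injective btemp).mp (clause2_of_arithQuasiGeometricCorrespondenceStatement h)
    φ ψ h₁ h₂ k₁ k₂ hc

end Assembly

/-! ### Over `A`: local openness is automatic, classes have unique representatives (appended) -/

section OverA

/-- **Over `A`, every representative is locally open**: its arithmetic component is the bijection
`e : π̂₁(A_𝔊) ⥲ π̂₁(A_ℍ)`, whose range is all of `π̂₁(A_ℍ)` (so the binders `h₁`, `k₁ : IsLocallyOpen` of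
clauses 2–3 of the typed Thm 5.4 (iii) are dischargeable from `h₂`, `k₂ : IsOverA`).
[cite: MochizukiSemiAnbd2006, Def 5.1 (iv), p. 63] -/
theorem isLocallyOpen_of_isOverA {φ : ArithHom 𝓥 𝔊 ℍ} (hφ : ArithHom.IsOverA 𝔊 ℍ e φ) :
    φ.IsLocallyOpen := by
  have hr : Set.range φ.arith = Set.univ := by
    rw [Set.eq_univ_iff_forall]
    intro x
    obtain ⟨a, rfl⟩ := e.surjective x
    exact ⟨a, hφ a⟩
  show IsOpen (Set.range φ.arith)
  rw [hr]
  exact isOpen_univ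

/-- **Classes of morphisms over `A` have unique representatives**: in the quotient of representatives
`𝔊 → ℍ` by "up to composition with the inner action of `π̂₁(A)`" (`ArithHom.innerSetoid`, the hom-sets
of the category of `ArithmeticCategory.lean`), two representatives over `A` with the same class are
equal (`innerEquiv_iff_eq_of_isOverA`). [cite: MochizukiSemiAnbd2006, Def 5.1 (iv), p. 63] -/
theorem eq_of_quotientMk_eq_of_isOverA {φ ψ : ArithHom 𝓥 𝔊 ℍ} (hφ : ArithHom.IsOverA 𝔊 ℍ e φ)
    (hψ : ArithHom.IsOverA 𝔊 ℍ e ψ)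
    (h : (Quotient.mk (ArithHom.innerSetoid 𝔊 ℍ) φ) = Quotient.mk (ArithHom.innerSetoid 𝔊 ℍ) ψ) :
    φ = ψ :=
  (innerEquiv_iff_eq_of_isOverA hφ hψ).mp (Quotient.exact h)

/-- Hence "representative over `A` ↦ its class" is injective: over `A` one may work with
representatives as if they were the morphisms themselves. [cite: MochizukiSemiAnbd2006, Def 5.1 (iv), p. 63] -/
theorem quotientMk_injective_on_isOverA :
    Set.InjOn (Quotient.mk (ArithHom.innerSetoid 𝔊 ℍ)) {φ | ArithHom.IsOverA 𝔊 ℍ e φ} :=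
  fun _ hφ _ hψ h => eq_of_quotientMk_eq_of_isOverA hφ hψ h

end OverA

end Thm54iii

end Literature.AnabelianGeometry.SemiGraphs
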